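import Mathlib
import Summits.QuantumFields.BalabanUV.Beta.FP.PerfectFFBlockDecay
import Summits.QuantumFields.BalabanUV.Beta.FP.LegPairingBounds

/-!
# Road «FP», row IR-5′ (c′) — FILE F7: the perfect ff leg IN THE CURRENCY OF THE END's FAR LETTER `hfar`:
# `|blk (KPerf m) tt s s′ c e| ≤ (Lc^m)^8 · (CF ∕ ‖s′−s‖∞⁶ · e^{−(af∕Lc^m)‖s′−s‖∞})`, ONE `(CF, af)` FOR ALL `m ≥ 1` (and the bubble `Γ²` likewise)

Cell `pub-balaban`, β sub-cell, binder row D1, road «FP» (owner `b2b-balaban-beta-d1-p3`), lane (U2) IR-5′ (unit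
`b2b-balaban-beta-d1-formalise-leaf-05`, gen 17).  The END of record (`RoadAsympEndLeft` ∕ `RoadLeftAssemblyRows` l.164–167) displays
`hfar : ∀ m ≥ 1, ∀ c e s s′, Lc^m < supNorm (s′ − s) → |fineHessA (KPerf m) (S m) (Wf m) c e s s′| ≤ ((Lc^m : ℕ) : ℝ)^8 · (CF ∕ (supNorm (s′−s) : ℝ)^6 ·
exp (−(af ∕ ((Lc^m : ℕ) : ℝ)) · supNorm (s′ − s)))` with `(CF, af)` m-UNIFORM (owner Q-d1leaf05g16-2).  This file converts the ff-leg letters of F6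
(`PerfectFFBlockDecay`: amplitude `(Lc^m)²`, rate `δ₁∕Lc^m`, m-uniform) into EXACTLY that envelope shape — the identity behind it is
`n²·e^{−(δ₁∕n)r} = n²·e^{−(af∕n)r}·e^{−((δ₁−af)∕n)r} ≤ n²·e^{−(af∕n)r}·720·n⁶∕((δ₁−af)⁶r⁶) = n⁸·(720∕(δ₁−af)⁶)∕r⁶·e^{−(af∕n)r}` (`t⁶e^{−εt} ≤ 720∕ε⁶`,
Mathlib `Real.pow_div_factorial_le_exp`; `‖·‖∞ ≤ |·|₁` is `LegPairingBounds.supNorm_le_l1`):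
* `pow_six_mul_exp_neg_le` — `t⁶·e^{−εt} ≤ 720∕ε⁶` (`0 ≤ t`, `0 < ε`);
* `decay_to_farEnvelope` — the generic conversion of a `C·n²·e^{−(δ∕n)|z|₁}` letter into `n⁸·(C·720∕(δ−a)⁶)∕‖z‖∞⁶·e^{−(a∕n)‖z‖∞}` for `0 < a < δ`, `0 < ‖z‖∞`;
* **`abs_blk_KPerf_ff_le_farEnvelope`** — `∃ af CF, 0 < af ∧ 0 ≤ CF ∧ ∀ m ≥ 1, ∀ c e s s′, 0 < supNorm (s′ − s) →
  |blk (KPerf … m) true true s s′ c e| ≤ ((Lc^m : ℕ) : ℝ)^8 · (CF ∕ (supNorm (s′−s) : ℝ)^6 · exp (−(af ∕ ((Lc^m : ℕ) : ℝ)) · supNorm (s′ − s)))`;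
* **`sq_blk_KPerf_ff_le_farEnvelope`** — the same for `(blk (KPerf m) tt s s′ c e)²` (the bubble currency of F6).

HONEST SCOPE: [our object] about the ff LEG only, in the END's far currency; the END's `hfar` is about the fineHessA WORDS (tadpole + bubble with the
jets `S m`, `Wf m` and the other blocks of `KPerf`) — their bookkeeping is the owner's ledger (`FineSplitJunctionFar`), NOT done here.  Constants existential
(through gan24's `δ₀, C₀`).  0∕4 row-D1 binders; NOT hfar, NOT hslice, NOT (ASYMP), NOT D1, NOT BetaPertH, NOT continuum, NOT Clay.  HONEST DEPENDENCY:
continuum YM on T⁴ ⇐ BetaPertH ∧ nine spine estimates (0/9 proved); BetaPertH ⇐ (D1) ∧ (D4) ∧ CAP+tail; G-an2-4 gates asym, D1 and NE2/3/4.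
-/

noncomputable section

open scoped BigOperators

namespace Summit.QuantumFields.BalabanUV.Beta.FP.PerfectFFBlockFarEnvelope

open Literature.MathematicalPhysics.QuantumFieldTheory.Balaban1983to89
open Literature.MathematicalPhysics.QuantumFieldTheory.Balaban1983to89.Beta
open B12Sec2to5 (l1 l1_nonneg)
open ExpKernelCalculus (Decays)
open DyadicShell (Pt supNorm)
open Summit.QuantumFields.BalabanUV.Beta.GAN24.CombesThomas (sfStep smStep)
open Summit.QuantumFields.BalabanUV.Beta.FP.PerfectObjectsT (KPerf)
open Summit.QuantumFields.BalabanUV.Beta.D1BFx.PackedKernelSplit (blk)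
open Summit.QuantumFields.BalabanUV.Beta.FP.PerfectFFBlockDecay (decays_blk_KPerf_ff_sq decays_sq_blk_KPerf_ff)
open Summit.QuantumFields.BalabanUV.Beta.FP.LegPairingBounds (supNorm_le_l1)

/-! ## §1 Generic: from an `n²`-amplitude exponential letter to the `n⁸∕r⁶` far envelope -/

/-- `t⁶·e^{−εt} ≤ 720∕ε⁶` for `t ≥ 0`, `ε > 0` (`(εt)⁶∕6! ≤ e^{εt}`). [folklore] -/
theorem pow_six_mul_exp_neg_le {t ε : ℝ} (ht : 0 ≤ t) (hε : 0 < ε) : t ^ 6 * Real.exp (-(ε * t)) ≤ 720 / ε ^ 6 := by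
  have h' : (ε * t) ^ 6 ≤ 720 * Real.exp (ε * t) := by
    have h := Real.pow_div_factorial_le_exp (ε * t) (by positivity) 6
    rw [show ((Nat.factorial 6 : ℕ) : ℝ) = 720 by norm_num [Nat.factorial],
      div_le_iff₀ (by norm_num : (0 : ℝ) < 720)] at h
    linarith
  rw [le_div_iff₀ (pow_pos hε 6)]
  have hE : Real.exp (ε * t) * Real.exp (-(ε * t)) = 1 := by rw [← Real.exp_add, add_neg_cancel, Real.exp_zero]
  have hpos : 0 < Real.exp (-(ε * t)) := Real.exp_pos _
  calc t ^ 6 * Real.exp (-(ε * t)) * ε ^ 6 = (ε * t) ^ 6 * Real.exp (-(ε * t)) := by ring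
    _ ≤ 720 * Real.exp (ε * t) * Real.exp (-(ε * t)) := mul_le_mul_of_nonneg_right h' hpos.le
    _ = 720 := by rw [mul_assoc, hE, mul_one]

/-- **THE CONVERSION**: a letter `C·n²·e^{−(δ∕n)L}` with `‖z‖∞ = r ≤ L` (`0 < r`) is below the far envelope
`n⁸·(C·720∕(δ−a)⁶)∕r⁶·e^{−(a∕n)r}` for every `0 < a < δ`. [folklore] -/
theorem decay_to_farEnvelope {C δ a n r L : ℝ} (hC : 0 ≤ C) (hn : 0 < n) (ha : 0 < a) (haδ : a < δ) (hr : 0 < r) (hrL : r ≤ L) :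
    C * n ^ 2 * Real.exp (-(δ / n) * L) ≤ n ^ 8 * (C * (720 / (δ - a) ^ 6) / r ^ 6 * Real.exp (-(a / n) * r)) := by
  have hδn : 0 < δ / n := div_pos (ha.trans haδ) hn
  have h1 : Real.exp (-(δ / n) * L) ≤ Real.exp (-(δ / n) * r) := Real.exp_le_exp.mpr (by nlinarith)
  have hsplit : Real.exp (-(δ / n) * r) = Real.exp (-(a / n) * r) * Real.exp (-((δ - a) * (r / n))) := by
    rw [← Real.exp_add]
    congr 1
    ring
  have h2 : (r / n) ^ 6 * Real.exp (-((δ - a) * (r / n))) ≤ 720 / (δ - a) ^ 6 :=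
    pow_six_mul_exp_neg_le (by positivity) (by linarith)
  have hrn : 0 < (r / n) ^ 6 := by positivity
  have h3 : Real.exp (-((δ - a) * (r / n))) ≤ 720 / (δ - a) ^ 6 / (r / n) ^ 6 := by
    rw [le_div_iff₀ hrn, mul_comm]
    exact h2
  have hea : 0 ≤ Real.exp (-(a / n) * r) := (Real.exp_pos _).le
  calc C * n ^ 2 * Real.exp (-(δ / n) * L) ≤ C * n ^ 2 * Real.exp (-(δ / n) * r) :=
        mul_le_mul_of_nonneg_left h1 (by positivity)
    _ = C * n ^ 2 * (Real.exp (-(a / n) * r) * Real.exp (-((δ - a) * (r / n)))) := by rw [hsplit]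
    _ ≤ C * n ^ 2 * (Real.exp (-(a / n) * r) * (720 / (δ - a) ^ 6 / (r / n) ^ 6)) :=
        mul_le_mul_of_nonneg_left (mul_le_mul_of_nonneg_left h3 hea) (by positivity)
    _ = n ^ 8 * (C * (720 / (δ - a) ^ 6) / r ^ 6 * Real.exp (-(a / n) * r)) := by
        field_simp

/-! ## §2 The perfect ff leg in `hfar`'s currency -/

variable {Lc : ℕ} [NeZero Lc]

/-- [our object] **THE PERFECT ff LEG UNDER THE END's FAR ENVELOPE, m-UNIFORMLY** (d = 3, `2 ≤ Lc`):
`∃ af > 0, CF ≥ 0, ∀ m ≥ 1, ∀ c e s s′, 0 < ‖s′ − s‖∞ → |blk (KPerf … m) true true s s′ c e| ≤ (Lc^m)^8·(CF∕‖s′−s‖∞⁶·e^{−(af∕Lc^m)‖s′−s‖∞})`. -/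
theorem abs_blk_KPerf_ff_le_farEnvelope (hLc : 2 ≤ Lc) : ∃ af CF : ℝ, 0 < af ∧ 0 ≤ CF ∧ ∀ m : ℕ, 1 ≤ m →
    ∀ (c e : Fin 4) (s s' : Pt), 0 < supNorm (s' - s) →
      |blk (KPerf (d := 3) Lc (sfStep Lc) (smStep 3 Lc) m) true true s s' c e|
        ≤ ((Lc ^ m : ℕ) : ℝ) ^ 8 * (CF / (supNorm (s' - s) : ℝ) ^ 6
            * Real.exp (-(af / ((Lc ^ m : ℕ) : ℝ)) * (supNorm (s' - s) : ℝ))) := by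
  obtain ⟨δ₁, C₂, hδ₁, hC₂, hD⟩ := decays_blk_KPerf_ff_sq (Lc := Lc) hLc
  refine ⟨δ₁ / 2, C₂ * (720 / (δ₁ - δ₁ / 2) ^ 6), by positivity, by positivity, fun m hm c e s s' hsup => ?_⟩
  have hn : (0 : ℝ) < (Lc : ℝ) ^ m := by positivity
  have hr : (0 : ℝ) < (supNorm (s' - s) : ℝ) := by exact_mod_cast hsup
  have hrL : (supNorm (s' - s) : ℝ) ≤ l1 (s - s') := by
    rw [ExpKernelCalculus.l1_sub_symm s s']
    exact supNorm_le_l1 (s' - s)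
  have hletter := hD m hm s s' c e
  push_cast
  exact hletter.trans (decay_to_farEnvelope hC₂ hn (by positivity) (by linarith) hr hrL)

/-- [our object] **THE BUBBLE OF THE PERFECT ff LEG UNDER THE SAME ENVELOPE, m-UNIFORMLY**: the square of the ff block obeys the far envelope
with its own `(CF′, af′)`. -/
theorem sq_blk_KPerf_ff_le_farEnvelope (hLc : 2 ≤ Lc) : ∃ af CF : ℝ, 0 < af ∧ 0 ≤ CF ∧ ∀ m : ℕ, 1 ≤ m →
    ∀ (c e : Fin 4) (s s' : Pt), 0 < supNorm (s' - s) →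
      (blk (KPerf (d := 3) Lc (sfStep Lc) (smStep 3 Lc) m) true true s s' c e) ^ 2
        ≤ ((Lc ^ m : ℕ) : ℝ) ^ 8 * (CF / (supNorm (s' - s) : ℝ) ^ 6
            * Real.exp (-(af / ((Lc ^ m : ℕ) : ℝ)) * (supNorm (s' - s) : ℝ))) := by
  obtain ⟨δ₁, C₃, hδ₁, hC₃, hD⟩ := decays_sq_blk_KPerf_ff (Lc := Lc) hLc
  refine ⟨δ₁ / 2, C₃ * (720 / (δ₁ - δ₁ / 2) ^ 6), by positivity, by positivity, fun m hm c e s s' hsup => ?_⟩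
  have hn : (0 : ℝ) < (Lc : ℝ) ^ m := by positivity
  have hr : (0 : ℝ) < (supNorm (s' - s) : ℝ) := by exact_mod_cast hsup
  have hrL : (supNorm (s' - s) : ℝ) ≤ l1 (s - s') := by
    rw [ExpKernelCalculus.l1_sub_symm s s']
    exact supNorm_le_l1 (s' - s)
  have hletter := hD m hm s s' c e
  push_cast
  exact hletter.trans (decay_to_farEnvelope hC₃ hn (by positivity) (by linarith) hr hrL)

end Summit.QuantumFields.BalabanUV.Beta.FP.PerfectFFBlockFarEnvelope
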